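import Summits.QuantumFields.YangMills.Theorems.ToronSmallBallSheetTranslate
import HarnessLib

/-!
# The sheet translate maps the toron core into the annulus of its own distance-to-centre

Support module for the translate cruxes `ToronSmallBall.ToronCoreRaritySubQuartic` ⟨stmt-QuantumFields-23956⟩ and `QuantileBitPurity.HolonomyQuantileSubQuartic`
⟨23948⟩ (and the strip cruxes ⟨23957⟩, ⟨23949⟩) of seat ym-idea-4's LINE g12-A/B (memo HOME `bc/g12-A/PLAN-X1-v2-gauss.md` §3: «the ± pair of sheet
translates maps CORE into the annulus `ANN_k = {|polDist − kδ'| ≤ β^{−γc}}`»).  The one-dimensional `SU(2)` fact behind it, with no estimate hidden: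

* `abs_vacDist_mul_sub_le` — `|vacDist(h·P) − vacDist(h)| ≤ vacDist(P)`: left-multiplying by `h` moves the distance to the centre `{±1}` by at most the
  distance of `P` to the centre (pick the centre sign `ε` nearest to `P`, `vacDist(h·P) = vacDist(h·εP)`, and `vacDist` is `1`-Lipschitz with
  `‖h(εP) − h‖_F = ‖εP − 1‖_F`);
* ★ `abs_polDist_twist_zero_sub_le` — for the `x`-sheet translate of the tree (`twist 0 h`, non-central `h`): `|polDist(twist 0 h U) − vacDist h| ≤ polDist U`,
  so (`polDist_twist_zero_mem_annulus`) the core `{polDist ≤ r}` is mapped into the annulus `{|polDist − vacDist h| ≤ r}`; with `exists_vacDist_eq`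
  every radius `t ∈ [0, 2]` is `vacDist h` for some `h`.

HONEST FRAMING: elementary `SU(2)` geometry for doors/cruxes of DRAFT lines onto RECORD rungs; nothing about infinite volume, the continuum limit or the
Clay gap.  No `sorry`, no new axiom, no new definition.  References: [cite: Luscher1983, §2]; [cite: tHooft1979].
-/

set_option autoImplicit false

noncomputable section

open Literature.MathematicalPhysics.QuantumFieldTheory
open Literature.MathematicalPhysics.QuantumLattice

namespace Summit.QuantumFields.YangMills.Theorems.FemtoTransferGap

/-- **Left multiplication moves the distance to the centre by at most the factor's own distance to the centre, and vice versa**: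
`|vacDist(h·P) − vacDist(h)| ≤ vacDist(P)`. [folklore] -/
theorem abs_vacDist_mul_sub_le (h P : SU2) : |vacDist (h * P) - vacDist h| ≤ vacDist P := by
  obtain ⟨ε, hε, hεP⟩ := exists_sign_vacDist P
  have hcomm : ε * (h * P) = h * (ε * P) := by
    have hc : ∀ g : SU2, g * ε = ε * g := fun g => Subgroup.mem_center_iff.1 hε g
    rw [← mul_assoc, ← hc h, mul_assoc]
  have h1 : vacDist (h * P) = vacDist (h * (ε * P)) := by rw [← hcomm, vacDist_center_mul hε]
  rw [h1]
  refine (abs_vacDist_sub_le (h * (ε * P)) h).trans ?_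
  have e1 : ((h * (ε * P) : SU2) : Matrix (Fin 2) (Fin 2) ℂ) - (h : Matrix (Fin 2) (Fin 2) ℂ) =
      (h : Matrix (Fin 2) (Fin 2) ℂ) * (((ε * P : SU2) : Matrix (Fin 2) (Fin 2) ℂ) - 1) := by
    rw [Matrix.mul_sub, Matrix.mul_one, ← Submonoid.coe_mul]
  rw [e1, frobNorm_unitary_mul (su2_mem_unitaryGroup h), hεP]

/-- ★ **The `x`-sheet translate moves the core into the annulus of radius `vacDist h`**: `|polDist(twist 0 h U) − vacDist h| ≤ polDist U`
(`polDist (twist 0 h U) = vacDist (h · polyX U)`, tree `polyX_twist_zero`). [cite: Luscher1983, §2] -/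
theorem abs_polDist_twist_zero_sub_le {L : ℕ} [NeZero L] (h : SU2) (U : GaugeConfig 3 L SU2) :
    |FlatSheet.polDist (twist 0 h U) - vacDist h| ≤ FlatSheet.polDist U := by
  rw [polDist_twist_zero]
  exact abs_vacDist_mul_sub_le h (FlatSheet.polyX U)

/-- The core `{polDist ≤ r}` is mapped by `twist 0 h` into the annulus `{|polDist − vacDist h| ≤ r}`. [cite: Luscher1983, §2] -/
theorem polDist_twist_zero_mem_annulus {L : ℕ} [NeZero L] (h : SU2) {U : GaugeConfig 3 L SU2} {r : ℝ} (hU : FlatSheet.polDist U ≤ r) :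
    |FlatSheet.polDist (twist 0 h U) - vacDist h| ≤ r :=
  (abs_polDist_twist_zero_sub_le h U).trans hU

/-- The bound backwards along the inverse translate (`twist 0 h⁻¹ ∘ twist 0 h = id`): `polDist U ≤ polDist (twist 0 h U) + vacDist h⁻¹` — a configuration
whose translate lies deep in the core was itself within `vacDist h⁻¹` of the core. [folklore] -/
theorem polDist_le_polDist_twist_zero_add {L : ℕ} [NeZero L] (h : SU2) (U : GaugeConfig 3 L SU2) :
    FlatSheet.polDist U ≤ FlatSheet.polDist (twist 0 h U) + vacDist h⁻¹ := by
  have hback : twist 0 h⁻¹ (twist 0 h U) = U := by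
    funext e
    simp only [twist]
    split_ifs
    · rw [← mul_assoc, inv_mul_cancel, one_mul]
    · rfl
  have h1 := abs_polDist_twist_zero_sub_le h⁻¹ (twist 0 h U)
  rw [hback] at h1
  have := (abs_sub_le_iff.1 h1).1
  linarith

end Summit.QuantumFields.YangMills.Theorems.FemtoTransferGap

end
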